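import Summits.Ventures.PackingBounds.Configurations.CrossPolytopeUnique
import Literature.Geometry.DiscreteGeometry.KissingNumberFourUniqueness
import Summits.Ventures.PackingBounds.Energy.NewtonCertificate

/-!
# Energy rigidity of the cross-polytope: ground states of `(1+t)^k`, `k ≥ 3`, among `2n` points are cross-polytopes

Framing: lottery ticket; floor = certified bounds/negative ranges. Venture `PackingBounds` (cell
`pub-packcert`, seat `pub-packcert-energy`) — Cohn–Kumar Table 1, cross-polytope rows, ground-state uniqueness.

Elementary certificate: the Hermite interpolant `p_k(t) = 1 + k t + (k-1) t²` of `(1+t)^k` at the nodes `-1`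
(simple) and `0` (double) satisfies `(1+t)^k - p_k(t) = (1+t)(g_{k-1}(t) + (k-2)t²) ≥ 0` on `[-1, ∞)`, strictly
off `{-1, 0}` for `k ≥ 3` (`hermite_nonneg`, `hermite_pos`). Summing over ordered pairs of `N = 2n` unit vectors
of `ℝⁿ` and using `Σ_{x ≠ y} ⟪x,y⟫ = ‖Σ x‖² - N ≥ -N` and the frame bound `Σ_{x,y} ⟪x,y⟫² ≥ N²/n` (tree:
`d4u_frame_potential`) gives `E_{(1+t)^k} ≥ 2n(2n-2)`, the cross-polytope value, with equality only if every
inner product is `0` or `-1` (`inner_eq_zero_or_of_ckPow_energy_le`). By `CrossPolytopeUnique` any two such ground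
states are isometric (`isometric_of_ckPow_energy_le`): the regular cross-polytope is the unique ground state.

## References
* H. Cohn, A. Kumar, J. Amer. Math. Soc. 20 (2007) 99–148, Table 1. [`CohnKumar2006`]
-/

noncomputable section

namespace Summit.Ventures.PackingBounds.Config.CrossPolytopeUnique

open Finset Literature.Geometry.DiscreteGeometry

variable {n : ℕ}

/-- Hermite remainder, nonnegativity: `(1+t)^{m+2} ≥ 1 + (m+2)t + (m+1)t²` for `t ≥ -1`. [folklore] -/
theorem hermite_nonneg (m : ℕ) {t : ℝ} (ht : -1 ≤ t) :
    0 ≤ (1 + t) ^ (m + 2) - 1 - (m + 2 : ℝ) * t - (m + 1 : ℝ) * t ^ 2 := by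
  induction m with
  | zero => norm_num; nlinarith
  | succ m ih =>
    have key : (1 + t) ^ (m + 1 + 2) - 1 - ((m + 1 : ℕ) + 2 : ℝ) * t - ((m + 1 : ℕ) + 1 : ℝ) * t ^ 2 =
        (1 + t) * (((1 + t) ^ (m + 2) - 1 - (m + 2 : ℝ) * t - (m + 1 : ℝ) * t ^ 2) + (m + 1 : ℝ) * t ^ 2) := by
      push_cast; ring
    rw [key]
    have h1 : 0 ≤ 1 + t := by linarith
    have h2 : 0 ≤ (m + 1 : ℝ) * t ^ 2 := by positivity
    exact mul_nonneg h1 (by linarith)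

/-- Hermite remainder, strictness: for `k = m + 3 ≥ 3`, `(1+t)^k > 1 + k t + (k-1)t²` when `-1 < t`, `t ≠ 0`. [folklore] -/
theorem hermite_pos (m : ℕ) {t : ℝ} (ht : -1 < t) (ht0 : t ≠ 0) :
    0 < (1 + t) ^ (m + 3) - 1 - (m + 3 : ℝ) * t - (m + 2 : ℝ) * t ^ 2 := by
  have key : (1 + t) ^ (m + 3) - 1 - (m + 3 : ℝ) * t - (m + 2 : ℝ) * t ^ 2 =
      (1 + t) * (((1 + t) ^ (m + 2) - 1 - (m + 2 : ℝ) * t - (m + 1 : ℝ) * t ^ 2) + (m + 1 : ℝ) * t ^ 2) := by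
    ring
  rw [key]
  have h1 : 0 < 1 + t := by linarith
  have h2 : 0 < (m + 1 : ℝ) * t ^ 2 := by positivity
  exact mul_pos h1 (by linarith [hermite_nonneg m ht.le])

/-- For unit vectors, `Σ_{x ≠ y} ⟪x,y⟫ = ‖Σ x‖² - |C|`. [folklore] -/
private theorem sum_inner_erase_eq'' (C : Finset (EuclideanSpace ℝ (Fin n))) (h1 : ∀ x ∈ C, ‖x‖ = 1) :
    ∑ x ∈ C, ∑ y ∈ C.erase x, inner ℝ x y = ‖∑ x ∈ C, x‖ ^ 2 - C.card := by
  classical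
  have hnorm : ‖∑ x ∈ C, x‖ ^ 2 = ∑ x ∈ C, ∑ y ∈ C, inner ℝ x y := by
    rw [← real_inner_self_eq_norm_sq, sum_inner]
    exact Finset.sum_congr rfl fun x _ => inner_sum _ _ _
  have hdiag : ∀ x ∈ C, ∑ y ∈ C.erase x, inner ℝ x y = ∑ y ∈ C, inner ℝ x y - 1 := by
    intro x hx
    rw [← Finset.sum_erase_add _ _ hx, real_inner_self_eq_norm_sq, h1 x hx]; ring
  rw [Finset.sum_congr rfl hdiag, Finset.sum_sub_distrib, hnorm]
  simp

/-- **Frame bound for the off-diagonal inner products**: for unit vectors of `ℝⁿ` (`n ≥ 1`),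
`Σ_{x ≠ y} ⟪x,y⟫² ≥ |C|²/n - |C|`. [folklore] -/
theorem sum_inner_sq_erase_ge (hn : 1 ≤ n) (C : Finset (EuclideanSpace ℝ (Fin n))) (h1 : ∀ x ∈ C, ‖x‖ = 1) :
    (C.card : ℝ) ^ 2 / n - C.card ≤ ∑ x ∈ C, ∑ y ∈ C.erase x, inner ℝ x y ^ 2 := by
  classical
  have hframe := d4u_frame_potential (EuclideanSpace.basisFun (Fin n) ℝ) C h1
  rw [Fintype.card_fin] at hframe
  have hn' : (0 : ℝ) < n := by exact_mod_cast hn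
  have hdiag : ∀ x ∈ C, ∑ y ∈ C.erase x, inner ℝ x y ^ 2 = ∑ y ∈ C, inner ℝ x y ^ 2 - 1 := by
    intro x hx
    rw [← Finset.sum_erase_add _ _ hx, real_inner_self_eq_norm_sq, h1 x hx]; ring
  rw [Finset.sum_congr rfl hdiag, Finset.sum_sub_distrib, sum_const, nsmul_eq_mul, mul_one]
  have h : (C.card : ℝ) ^ 2 / n ≤ ∑ x ∈ C, ∑ y ∈ C, inner ℝ x y ^ 2 := by
    rw [div_le_iff₀ hn']; linarith
  linarith

/-- **Energy rigidity of the cross-polytope.** If `2n` unit vectors of `ℝⁿ` (`n ≥ 1`) have `(1+t)^{m+3}`-energy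
at most the cross-polytope value `2n(2n-2)`, then every inner product of two distinct points is `0` or `-1`.
[cite: CohnKumar2006, Table 1] -/
theorem inner_eq_zero_or_of_ckPow_energy_le (hn : 1 ≤ n) (m : ℕ) (C : Finset (EuclideanSpace ℝ (Fin n)))
    (h1 : ∀ x ∈ C, ‖x‖ = 1) (hcard : C.card = 2 * n)
    (hE : ∑ x ∈ C, ∑ y ∈ C.erase x, (1 + inner ℝ x y) ^ (m + 3) ≤ (2 * n : ℝ) * (2 * n - 2))
    {x y : EuclideanSpace ℝ (Fin n)} (hx : x ∈ C) (hy : y ∈ C) (hxy : x ≠ y) :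
    inner ℝ x y = 0 ∨ inner ℝ x y = -1 := by
  classical
  set g : ℝ → ℝ := fun t => (1 + t) ^ (m + 3) - 1 - (m + 3 : ℝ) * t - (m + 2 : ℝ) * t ^ 2 with hgdef
  have hb : ∀ x ∈ C, ∀ y ∈ C.erase x, -1 ≤ inner ℝ x y ∧ inner ℝ x y < 1 := fun x hx y hy =>
    Summit.Ventures.PackingBounds.Energy.NewtonCert.inner_mem_Ico_of_norm_eq_one (h1 x hx) (h1 y (Finset.mem_of_mem_erase hy))
      (Finset.ne_of_mem_erase hy).symm
  have hgnn : ∀ x ∈ C, ∀ y ∈ C.erase x, 0 ≤ g (inner ℝ x y) := fun x hx y hy => by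
    have h := hermite_nonneg (m + 1) (hb x hx y hy).1
    rw [hgdef]; push_cast at h ⊢; linarith
  -- the three sums
  have hS1 := sum_inner_erase_eq'' C h1
  have hS2 := sum_inner_sq_erase_ge hn C h1
  have hN : (C.card : ℝ) = 2 * n := by exact_mod_cast hcard
  have hn' : (0 : ℝ) < n := by exact_mod_cast hn
  have hcount : ∀ c : ℝ, ∑ x ∈ C, ∑ y ∈ C.erase x, c = (C.card : ℝ) * ((C.card : ℝ) - 1) * c := by
    intro c
    rw [Finset.sum_congr rfl fun x hx => by rw [Finset.sum_const, Finset.card_erase_of_mem hx]]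
    rw [Finset.sum_const, nsmul_eq_mul, nsmul_eq_mul, Nat.cast_sub (by omega)]
    push_cast; ring
  have hdec : ∑ x ∈ C, ∑ y ∈ C.erase x, g (inner ℝ x y) =
      ∑ x ∈ C, ∑ y ∈ C.erase x, (1 + inner ℝ x y) ^ (m + 3) - ∑ x ∈ C, ∑ y ∈ C.erase x, (1 : ℝ) -
        (m + 3 : ℝ) * ∑ x ∈ C, ∑ y ∈ C.erase x, inner ℝ x y -
        (m + 2 : ℝ) * ∑ x ∈ C, ∑ y ∈ C.erase x, inner ℝ x y ^ 2 := by
    simp only [hgdef, Finset.sum_sub_distrib, Finset.mul_sum]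
  have hle0 : ∑ x ∈ C, ∑ y ∈ C.erase x, g (inner ℝ x y) ≤ 0 := by
    rw [hdec, hcount, hS1, hN]
    rw [hN] at hS2
    have hsq : 0 ≤ ‖∑ x ∈ C, x‖ ^ 2 := by positivity
    have h2 : (2 * n : ℝ) ^ 2 / n = 4 * n := by
      field_simp; ring
    rw [h2] at hS2
    nlinarith [hS2, hsq, hE]
  have hsum0 : ∑ x ∈ C, ∑ y ∈ C.erase x, g (inner ℝ x y) = 0 :=
    le_antisymm hle0 (Finset.sum_nonneg fun x hx => Finset.sum_nonneg fun y hy => hgnn x hx y hy)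
  have hyx : y ∈ C.erase x := Finset.mem_erase.mpr ⟨hxy.symm, hy⟩
  have hx0 := (Finset.sum_eq_zero_iff_of_nonneg fun x hx =>
    Finset.sum_nonneg fun y hy => hgnn x hx y hy).mp hsum0 x hx
  have hxy0 := (Finset.sum_eq_zero_iff_of_nonneg fun y hy => hgnn x hx y hy).mp hx0 y hyx
  by_contra hne
  push Not at hne
  have hgt : -1 < inner ℝ x y := lt_of_le_of_ne (hb x hx y hyx).1 (fun h => hne.2 h.symm)
  have hpos := hermite_pos m hgt hne.1
  rw [hgdef] at hxy0
  exact absurd hxy0 (ne_of_gt hpos)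

/-- **Uniqueness of the cross-polytope ground states** (`n ≥ 3`, `k = m + 3 ≥ 3`): two `2n`-point configurations
on `S^{n-1}` with `(1+t)^k`-energy at most `2n(2n-2)` are isometric; both are regular cross-polytopes.
[cite: CohnKumar2006, Table 1] -/
theorem isometric_of_ckPow_energy_le (hn : 3 ≤ n) (m : ℕ) (C C' : Finset (EuclideanSpace ℝ (Fin n)))
    (h1 : ∀ x ∈ C, ‖x‖ = 1) (hcard : C.card = 2 * n)
    (hE : ∑ x ∈ C, ∑ y ∈ C.erase x, (1 + inner ℝ x y) ^ (m + 3) ≤ (2 * n : ℝ) * (2 * n - 2))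
    (h1' : ∀ x ∈ C', ‖x‖ = 1) (hcard' : C'.card = 2 * n)
    (hE' : ∑ x ∈ C', ∑ y ∈ C'.erase x, (1 + inner ℝ x y) ^ (m + 3) ≤ (2 * n : ℝ) * (2 * n - 2)) :
    ∃ Ψ : EuclideanSpace ℝ (Fin n) ≃ₗᵢ[ℝ] EuclideanSpace ℝ (Fin n), C' = C.image Ψ := by
  have h0 : ∀ x ∈ C, ∀ y ∈ C, x ≠ y → inner ℝ x y ≤ 0 := fun x hx y hy hxy => by
    rcases inner_eq_zero_or_of_ckPow_energy_le (by omega) m C h1 hcard hE hx hy hxy with h | h <;> linarith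
  have h0' : ∀ x ∈ C', ∀ y ∈ C', x ≠ y → inner ℝ x y ≤ 0 := fun x hx y hy hxy => by
    rcases inner_eq_zero_or_of_ckPow_energy_le (by omega) m C' h1' hcard' hE' hx hy hxy with h | h <;> linarith
  exact isometric_of_crossPolytope_codes hn C C' h1 h0 hcard h1' h0' hcard'

end Summit.Ventures.PackingBounds.Config.CrossPolytopeUnique

end
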